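/-
Copyright (c) 2026 the pub-hodgecm-mathlib formalisation cell (harness21).  Prover seat hodgecm-mathlib-K2E3-p23 (g8), Track B «K2-LIT» ∕ hLiu418 #184♮,
Road I v3, unit U5 «THE CLOSE», FACE-D₀ row `h2₂`: THE S-LETTERS OF ★ U2a's σ-EXPLICIT LINE MODEL AT ONE FINITE PLACE `v` — PART 1, THE STRUCTURE LETTERS
(LEAD F0P6-plan (g15) BATCH #181 (5) ∕ #183 (2); K2Liu-p02 (g9) 2026-09-05T01:08:05Z «RESIDUE = K2E3-p23's S-letters»).  THEOREMS ONLY.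
-/
import Summits.HodgeConjecture.HodgeConjecture.Theorems.K2LiuFinChirpLocalGramReading          -- ★ p863978 (brings ★ p863716∕p863863 `K2LiuLocalRingTraceForm`, ★ p863351 `…SmallLetters`)
import Summits.HodgeConjecture.HodgeConjecture.Theorems.K2LiuUnipotentChartLocal              -- ★ p863656 the local chart; brings ★ (d1) `K2LiuSiegelUnipotentCharacterFactorisation`
import Literature.NumberTheory.GelbartRogawski1991.DoubledWeilRepresentationLocalFamilyCM    -- ★ `gramR_isSymm`
import Mathlib.Algebra.Algebra.Bilinear
import HarnessLib

/-!
# K2_Liu road (hLiu418 = stmt-HodgeConjecture-24832), U5 «THE CLOSE», FACE-D₀ row `h2₂`: THE STRUCTURE LETTERS `hπ hψ ha hherm hdet hχ hχS`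
# (and `hX`) OF ★ U2a's LINE MODEL AT THE INSTANCE `R := L ⊗ L⁺_v`, `σ := c ⊗ 1`, `ψ := ψ_{L⁺,v}`, `Z := N_Δ(L⁺_v)`, `ι := ι_v`

Cell `pub/hodgecm-mathlib` (D-0151), Track B, build stream 29; helper lane `--supports stmt-HodgeConjecture-24832 --as helper`, count-neutral; closes no socket.
THEOREMS ONLY (no `def`, no `instance`, no notation, no named-fact hypothesis, no `sorry`).

THE INSTANCE (★ p863332 `K2LiuFirstTermLineLiftRankRowModelConj` ∕ K2Liu-p02's ★-pending `K2LiuFirstTermLineLiftRankRowCayley.h2Row_thetaSide_of_lineCayley`):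
`R := LocalRing L v = L ⊗ L⁺_v`, `F := L⁺_v`, `σ := conjLocal L c v`, `π s H := Tr_{R∕F} tr(s H)`, `ψ := adeleAddCharAt L⁺ v`, `Z := ↥(unipDeltaLoc … v)`,
`ι z := ⟨ι_v z, _⟩` (★ `locToAdelic`), the Fourier index `S ∈ Skew_T(L)` (`T = gramR ⊗ L`, ★ `skewMatrices`) with `det S ≠ 0`, `δ := imagUnit L`, `d := imagUnitSq L`:
* §1 (ring-generic) `trace_delta_smul_mul_inv_mul` (`tr((δ • X T⁻¹)(δ′ • T S)) = δδ′ · tr(S X)`), `map_transpose_smul_mul_of_skew` (`δ′ • T S` is `σ`-hermitian for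
  `T`-skew `S`, `σ δ′ = −δ′`), reindex bookkeeping;
* §2 `hX` — `((blk (ι_v z)).toBlocks₁₂).map adeleFst = 0` (★ (d1) `map_fst_locToAdelic`), and the `v`-support of `X(ι_v z)`;
* §3 `hψ`, `ha`, the pairing `π` with `hπ` (★ p863716), packaged: **`exists_pairing`**;
* §4 **`coe_unipDeltaChar_locToAdelic_eq_adeleAddCharAt_trace`** — `ψ_S(ι_v z) = ψ_{L⁺,v}(Tr tr(S_v · X_v(z)))` (★ p863863 `adeleAddChar_eq_adeleAddCharAt_trace_of_support`
  on the adele `tr(S_𝔸 X(ι_v z))`, supported over `v` by ★ (d1)), and **`exists_beta_chi`** — the letters `βloc hherm hdet χ hχ hχS` at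
  `βloc := reindex ρ ρ (δ⁻¹ • (T_v S_v))`, `b z := reindex ρ ρ (δ • X_v(z) T_v⁻¹)`, `χ := ψ_S ∘ ι_v` (★ p863351).
The model letters `hb` (★ p863656's chart, transported) and `hρm`∕`hu` (★ p863978 on ★ p863869's `cMat` bytes) are PART 2.

References: [Rallis1984] §4; [KudlaRallis1994] §3; [Kudla1994] §3; [Shimura1997] §18.1 (18.4); [MoeglinWaldspurger1995] I.2.1, I.2.6;
[CasselsFrohlichANT1967] Ch. II §10–§11, Ch. XV §2.2; [Scharlau1985HermitianForms] Ch. 10 §1.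
HONEST LABEL: HC_CM is proved only modulo the 7 printed citations (2 remaining named inputs: hLiu418 = stmt-HodgeConjecture-24832, h413 = stmt-HodgeConjecture-24833)
until rung 0 closes; this file moves no counter; `h2₂` NOT discharged.
-/

set_option autoImplicit false
set_option linter.dupNamespace false -- the mandated namespace repeats `HodgeConjecture.HodgeConjecture`

noncomputable section

open scoped Matrix
open NumberField IsDedekindDomain
open Literature.NumberTheory.Automorphic Literature.NumberTheory.Automorphic.UnitaryGroup Literature.NumberTheory.GaloisRepresentations
open Literature.NumberTheory.GelbartRogawski1991 Literature.NumberTheory.GelbartRogawski1991.GRConstruction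
open Literature.NumberTheory.GelbartRogawski1991.UnitaryDualPair (imagUnit imagUnitSq complexConj_imagUnit imagUnit_ne_zero imagUnit_mul_self isUnit_det_gram
  isUnit_det_realDiagonal)
open Literature.NumberTheory.K2Lit.SiegelDoubled

namespace Summit.HodgeConjecture.HodgeConjecture.Cruxes.HLiu418.K2LiuFinLineModelLettersAtPlace

open K2LiuSiegelUnipotentFourierDefs (unipDeltaChar unipDeltaChar_apply skewMatrices mem_skewMatrices_iff map_mem_skewMatrices)
open K2LiuSiegelUnipotentLocalDefs (unipDeltaLoc locToAdelic_mem_unipDelta)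
open K2LiuSiegelUnipotentCharacterFactorisation (map_fst_locToAdelic map_adeleEval_locToAdelic_of_over map_adeleEval_locToAdelic_of_not_over
  map_trace_mul_toBlocks₁₂ toBlocks₁₂_reindex_one trace_mul_toBlocks₁₂_one)

/-! ## §1 Ring-generic algebra of the hermitian dressing -/
section Generic

variable {A : Type*} [CommRing A] {ι : Type*} [Fintype ι] [DecidableEq ι]

/-- **the trace dictionary**: `tr((δ • X T⁻¹) · (δ′ • T S)) = (δ δ′) · tr(S · X)` for `T⁻¹ T = 1`. [cite: Shimura1997, §18.1 (18.4)] -/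
theorem trace_delta_smul_mul_inv_mul (δ δ' : A) (X T Ti S : Matrix ι ι A) (hTi : Ti * T = 1) :
    Matrix.trace ((δ • (X * Ti)) * (δ' • (T * S))) = δ * δ' * Matrix.trace (S * X) := by
  rw [Matrix.smul_mul, Matrix.mul_smul, Matrix.trace_smul, Matrix.trace_smul, smul_eq_mul, smul_eq_mul, Matrix.mul_assoc, ← Matrix.mul_assoc Ti,
    hTi, Matrix.one_mul, Matrix.trace_mul_comm]
  ring

omit [DecidableEq ι] in
/-- **`δ′ • (T S)` is `σ`-hermitian for `T`-skew `S`**: `T S + σ(S)ᵀ T = 0`, `σ` fixes the symmetric `T`, `σ δ′ = −δ′` ⇒ `(σ(δ′ • T S))ᵀ = δ′ • T S`.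
[cite: Scharlau1985HermitianForms, Ch. 10 §1] [cite: Shimura1997, §18.1] -/
theorem map_transpose_smul_mul_of_skew (τ : A →+* A) (δ' : A) (hτδ : τ δ' = -δ') (T S : Matrix ι ι A) (hTτ : T.map τ = T) (hT : Tᵀ = T)
    (hS : T * S + (S.map τ)ᵀ * T = 0) : ((δ' • (T * S)).map τ)ᵀ = δ' • (T * S) := by
  have h2 : (S.map τ)ᵀ * T = -(T * S) := eq_neg_of_add_eq_zero_right hS
  rw [Matrix.map_smul' _ _ _ (map_mul τ), Matrix.transpose_smul, hτδ, Matrix.map_mul, hTτ, Matrix.transpose_mul, hT, h2, smul_neg, neg_smul, neg_neg]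

/-- the determinant of the dressing: `det(δ′ • T S) = δ′ ^ |ι| · det T · det S`. [folklore] -/
theorem det_smul_mul (δ' : A) (T S : Matrix ι ι A) : (δ' • (T * S)).det = δ' ^ Fintype.card ι * T.det * S.det := by
  rw [Matrix.det_smul, Matrix.det_mul, mul_assoc]

omit [CommRing A] [Fintype ι] [DecidableEq ι] in
/-- `reindex` preserves `σ`-hermitian-ness. [folklore] -/
theorem map_transpose_reindex [AddCommMonoid A] {κ : Type*} (ε : ι ≃ κ) (τ : A → A) (H : Matrix ι ι A) (hH : (H.map τ)ᵀ = H) :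
    ((Matrix.reindex ε ε H).map τ)ᵀ = Matrix.reindex ε ε H := by
  rw [Matrix.reindex_apply, ← Matrix.submatrix_map, Matrix.transpose_submatrix, hH]

omit [DecidableEq ι] in
/-- traces of products are `reindex`-invariant. [folklore] -/
theorem trace_reindex_mul_reindex {κ : Type*} [Fintype κ] (ε : ι ≃ κ) (X Y : Matrix ι ι A) :
    Matrix.trace (Matrix.reindex ε ε X * Matrix.reindex ε ε Y) = Matrix.trace (X * Y) := by
  rw [Matrix.reindex_apply, Matrix.reindex_apply, Matrix.submatrix_mul_equiv]
  exact Equiv.sum_comp ε.symm (fun i => (X * Y) i i)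

end Generic

/-! ## §2 The block coordinate `X(ι_v z)`: archimedean part `0` (`hX`), support over `v` -/
section Instance

variable (L : Type) [Field L] [NumberField L] [IsCMField L]
variable {N M n : ℕ} (e : Fin N × Fin M ≃ Fin n)
  (dV : Fin N → L) (hdV : ∀ i, IsCMField.complexConj L (dV i) = dV i)
  (dW : Fin M → L) (hdW : ∀ i, IsCMField.complexConj L (dW i) = dW i)
  (v : HeightOneSpectrum (𝓞 (Fp L)))

/-- **letter `hX` (`hfst` spelling)**: the block coordinate of `ι_v z` has ZERO archimedean part — `((blk (ι_v z)).toBlocks₁₂).map adeleFst = 0`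
(★ (d1) `map_fst_locToAdelic`: the archimedean matrix of `ι_v z` is `1`, whose `(1,2)`-block vanishes). This is K2Liu-p02's `hX` ∕ F0P2-p10's `hY`.
[cite: CasselsFrohlichANT1967, Ch. XV (Tate), §4.1] [cite: MoeglinWaldspurger1995, I.2.1] -/
theorem map_adeleFst_toBlocks₁₂_blk_locToAdelic (z : UnitaryGroup.localPi L (IsCMField.complexConj L) (n + n) (hermD L e dV hdV dW hdW) v) :
    ((blk L e dV hdV dW hdW (locToAdelic L e dV hdV dW hdW v z)).toBlocks₁₂).map (UnitaryGroup.adeleFst L) = 0 := by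
  rw [← (toBlocks_reindex_e₂_map (UnitaryGroup.adeleFst L) _).2.1, map_fst_locToAdelic, toBlocks₁₂_reindex_one]

/-- the block coordinate of `ι_v z` VANISHES at the finite places not over `v` (★ (d1) `map_adeleEval_locToAdelic_of_not_over`).
[cite: CasselsFrohlichANT1967, Ch. XV (Tate), §4.1] -/
theorem map_adeleEval_toBlocks₁₂_blk_locToAdelic_of_not_over (z : UnitaryGroup.localPi L (IsCMField.complexConj L) (n + n) (hermD L e dV hdV dW hdW) v)
    (w : HeightOneSpectrum (𝓞 L)) (hw : w.under (𝓞 (Fp L)) ≠ v) :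
    ((blk L e dV hdV dW hdW (locToAdelic L e dV hdV dW hdW v z)).toBlocks₁₂).map (AdelicGroupData.adeleEval L w) = 0 := by
  rw [← (toBlocks_reindex_e₂_map (AdelicGroupData.adeleEval L w) _).2.1, map_adeleEval_locToAdelic_of_not_over L e dV hdV dW hdW v z w hw,
    toBlocks₁₂_reindex_one]

/-! ## §3 `hψ`, `ha`, and the pairing `π s H = Tr tr(s H)` with `hπ` -/

omit [IsCMField L] in
/-- **letter `hψ`**: `ψ_{L⁺,v}` takes a value `≠ 1` (★ `exists_adeleAddCharAt_ne_one`). [cite: CasselsFrohlichANT1967, Ch. XV (Tate), §2.2] -/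
theorem exists_coe_adeleAddCharAt_ne_one : ∃ t : v.adicCompletion (Fp L), ((adeleAddCharAt (Fp L) v t : Circle) : ℂ) ≠ 1 := by
  obtain ⟨t, ht⟩ := exists_adeleAddCharAt_ne_one (Fp L) v
  exact ⟨t, fun h => ht (Circle.ext_iff.2 (by rw [h]; rfl))⟩

/-- **letter `ha`**: the scalar `a := ι_v(a₀)` is `σ ⊗ 1`-fixed (★ `conjLocal_toLocalRing`). [cite: CasselsFrohlichANT1967, Ch. II §10] -/
theorem conjLocal_toLocalRing_eq (a₀ : v.adicCompletion (Fp L)) :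
    conjLocal L (IsCMField.complexConj L) v (toLocalRing L v a₀) = toLocalRing L v a₀ :=
  conjLocal_toLocalRing (IsCMField.complexConj L) v a₀

/-- **the pairing `π s H := Tr_{L⊗L⁺_v∕L⁺_v} tr(s · H)` with letter `hπ`** (★ p863716 `exists_herm_pairing_ne_zero_localRing`) and continuity of `π s`
(★ p863978 `continuous_tracePairing`), as an `L⁺_v`-bilinear map on `M₂(L ⊗ L⁺_v)` (Mathlib `LinearMap.mul`, `Matrix.traceLinearMap`, `Algebra.trace`).
[cite: Rallis1984, §4] [cite: KudlaRallis1994, §3] -/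
theorem exists_pairing :
    ∃ π : Matrix (Fin 2) (Fin 2) (LocalRing L v) →ₗ[v.adicCompletion (Fp L)] Matrix (Fin 2) (Fin 2) (LocalRing L v) →ₗ[v.adicCompletion (Fp L)]
        v.adicCompletion (Fp L),
      (∀ s H, π s H = Algebra.trace (v.adicCompletion (Fp L)) (LocalRing L v) (s * H).trace) ∧
      (∀ H : Matrix (Fin 2) (Fin 2) (LocalRing L v), (H.map (conjLocal L (IsCMField.complexConj L) v))ᵀ = H → H ≠ 0 →
        ∃ s : Matrix (Fin 2) (Fin 2) (LocalRing L v), (s.map (conjLocal L (IsCMField.complexConj L) v))ᵀ = s ∧ π s H ≠ 0) ∧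
      (∀ s, Continuous (π s)) := by
  haveI : Algebra.IsQuadraticExtension (Fp L) L := IsCMField.isQuadraticExtension L
  let π : Matrix (Fin 2) (Fin 2) (LocalRing L v) →ₗ[v.adicCompletion (Fp L)] Matrix (Fin 2) (Fin 2) (LocalRing L v) →ₗ[v.adicCompletion (Fp L)]
      v.adicCompletion (Fp L) :=
    (LinearMap.mul (v.adicCompletion (Fp L)) (Matrix (Fin 2) (Fin 2) (LocalRing L v))).compr₂
      ((Algebra.trace (v.adicCompletion (Fp L)) (LocalRing L v)) ∘ₗ (Matrix.traceLinearMap (Fin 2) (v.adicCompletion (Fp L)) (LocalRing L v)))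
  have hπτ : ∀ s H, π s H = Algebra.trace (v.adicCompletion (Fp L)) (LocalRing L v) (s * H).trace := fun s H => rfl
  refine ⟨π, hπτ, fun H hH hH0 => ?_, fun s => ?_⟩
  · exact K2LiuLocalRingTraceForm.exists_herm_pairing_ne_zero_localRing (Fp L) L v (IsCMField.complexConj L) (complexConj_imagUnit L) (imagUnit_ne_zero L)
      (imagUnit_mul_self L) π hπτ H hH hH0
  · change Continuous fun H => π s H
    simp only [hπτ]
    exact K2LiuFinChirpLocalGramReading.continuous_tracePairing (Fp L) L v s

/-! ## §4 The character letters: `ψ_S(ι_v z) = ψ_{L⁺,v}(Tr tr(S_v · X_v(z)))`, and `βloc`, `χ`, `hherm`, `hdet`, `hχ`, `hχS` -/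

/-- **THE UNIPOTENT CHARACTER AT `ι_v z`, READ AT THE PLACE `v`**: `ψ_S(ι_v z) = ψ_{L⁺,v}(Tr_{L⊗L⁺_v∕L⁺_v} tr(S_v · X_v(z)))`, where `S_v = S ⊗ 1 ∈ M_n(L ⊗ L⁺_v)` and
`X_v(z) = X(ι_v z)|_v` is the block coordinate read over `v` — the adele `tr(S_𝔸 · X(ι_v z))` has zero archimedean part and vanishes off `v` (★ (d1)), so ★ p863863
`adeleAddChar_eq_adeleAddCharAt_trace_of_support` applies. [cite: Shimura1997, §18.1 (18.4)] [cite: CasselsFrohlichANT1967, Ch. XV (Tate), §2.2, Thm. 4.1.1] -/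
theorem unipDeltaChar_locToAdelic_eq_adeleAddCharAt_trace (S : Matrix (Fin n) (Fin n) L)
    (z : UnitaryGroup.localPi L (IsCMField.complexConj L) (n + n) (hermD L e dV hdV dW hdW) v) :
    unipDeltaChar L e dV hdV dW hdW S (locToAdelic L e dV hdV dW hdW v z) =
      adeleAddCharAt (Fp L) v (Algebra.trace (v.adicCompletion (Fp L)) (LocalRing L v)
        (Matrix.trace (S.map (algebraMap L (LocalRing L v)) *
          ((blk L e dV hdV dW hdW (locToAdelic L e dV hdV dW hdW v z)).toBlocks₁₂).map (fun x : AdeleRing (𝓞 L) L => finiteAdeleToLocal L v x.2)))) := by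
  haveI : Algebra.IsQuadraticExtension (Fp L) L := IsCMField.isQuadraticExtension L
  have h1 : (Matrix.trace (S.map (algebraMap L (AdeleRing (𝓞 L) L)) * (blk L e dV hdV dW hdW (locToAdelic L e dV hdV dW hdW v z)).toBlocks₁₂)).1 = 0 := by
    change UnitaryGroup.adeleFst L _ = 0
    rw [map_trace_mul_toBlocks₁₂, map_fst_locToAdelic, trace_mul_toBlocks₁₂_one]
  have hoff : ∀ u : HeightOneSpectrum (𝓞 L), u.under (𝓞 (Fp L)) ≠ v →
      (Matrix.trace (S.map (algebraMap L (AdeleRing (𝓞 L) L)) * (blk L e dV hdV dW hdW (locToAdelic L e dV hdV dW hdW v z)).toBlocks₁₂)).2 u = 0 := by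
    intro u hu
    change AdelicGroupData.adeleEval L u _ = 0
    rw [map_trace_mul_toBlocks₁₂, map_adeleEval_locToAdelic_of_not_over L e dV hdV dW hdW v z u hu, trace_mul_toBlocks₁₂_one]
  rw [unipDeltaChar_apply, K2LiuLocalRingTraceForm.adeleAddChar_eq_adeleAddCharAt_trace_of_support (Fp L) L v _ h1 hoff]
  congr 2
  change ((finiteAdeleToLocal L v).comp (UnitaryGroup.adeleSnd L)) _ = _
  rw [map_trace_mul_toBlocks₁₂, Matrix.map_map]
  have hS : (S.map (((finiteAdeleToLocal L v).comp (UnitaryGroup.adeleSnd L)) ∘ (algebraMap L (AdeleRing (𝓞 L) L)))) = S.map (algebraMap L (LocalRing L v)) :=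
    congrArg S.map (funext fun x => finiteAdeleToLocal_algebraMap L v x)
  rw [hS]
  rfl

/-- the local Gram matrix `T_v = gramR ⊗ 1 ∈ M_n(L ⊗ L⁺_v)` is `σ ⊗ 1`-fixed, symmetric, with unit determinant (★ `gramR_isSymm`, ★ `isUnit_det_gram`).
[cite: GelbartRogawski1991, §3.1 Prop. 3.1.1 p. 455 L1–2] -/
theorem localGram_map_conj_transpose_isUnit (hdV0 : ∀ i, dV i ≠ 0) (hdW0 : ∀ i, dW i ≠ 0) :
    (((gramR L e dV hdV dW hdW).map (algebraMap (Fp L) L)).map (algebraMap L (LocalRing L v))).map (conjLocal L (IsCMField.complexConj L) v) =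
        ((gramR L e dV hdV dW hdW).map (algebraMap (Fp L) L)).map (algebraMap L (LocalRing L v)) ∧
      (((gramR L e dV hdV dW hdW).map (algebraMap (Fp L) L)).map (algebraMap L (LocalRing L v)))ᵀ =
        ((gramR L e dV hdV dW hdW).map (algebraMap (Fp L) L)).map (algebraMap L (LocalRing L v)) ∧
      IsUnit (((gramR L e dV hdV dW hdW).map (algebraMap (Fp L) L)).map (algebraMap L (LocalRing L v))).det := by
  refine ⟨?_, ?_, ?_⟩
  · ext i j
    simp only [Matrix.map_apply]
    rw [conjLocal_algebraMap, AlgEquiv.commutes]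
  · rw [← Matrix.transpose_map, ← Matrix.transpose_map, (gramR_isSymm L e dV hdV dW hdW).eq]
  · rw [← RingHom.mapMatrix_apply, ← RingHom.mapMatrix_apply, ← RingHom.map_det, ← RingHom.map_det]
    exact ((isUnit_det_gram (Fp L) e (isUnit_det_realDiagonal L dV hdV hdV0) (isUnit_det_realDiagonal L dW hdW hdW0)).map _).map _

omit [IsCMField L] in
/-- `algebraMap L (L ⊗ L⁺_v)` is injective (read at one place `w ∣ v`). [cite: CasselsFrohlichANT1967, Ch. II §10] -/
theorem algebraMap_localRing_injective : Function.Injective (algebraMap L (LocalRing L v)) := by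
  obtain ⟨w⟩ := (inferInstance : Nonempty (UnitaryGroup.PlacesOver L v))
  intro x y hxy
  have h := congrFun hxy w
  exact (algebraMap L (w.1.adicCompletion L)).injective h

/-- **THE LETTERS `βloc hherm hdet χ hχ hχS` AT THE PLACE `v`.**  For a Fourier index `S ∈ Skew_T(L)` with `det S ≠ 0` and a re-enumeration `ρ : Fin n ≃ Fin 2`:
`βloc := reindex ρ ρ (δ⁻¹ • (T_v · S_v))` is `σ ⊗ 1`-hermitian (§1 `map_transpose_smul_mul_of_skew`) with `det βloc ≠ 0`, `χ := ψ_S ∘ ι_v` is a homomorphism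
`N_Δ(L⁺_v) →* ℂˣ` (★ p863351), `hχS` holds by construction, and **`hχ`: `χ z = ψ_{L⁺,v}(Tr tr(b z · βloc))`** with the hermitian dressing
`b z := reindex ρ ρ (δ • (X_v(z) · T_v⁻¹))` of the block coordinate (`tr((δ • X T⁻¹)(δ⁻¹ • T S)) = tr(S X)`, §1, and §4 `unipDeltaChar_locToAdelic_eq_adeleAddCharAt_trace`).
[cite: Rallis1984, §4] [cite: KudlaRallis1994, §3] [cite: Shimura1997, §18.1 (18.4)] -/
theorem exists_beta_chi (hdV0 : ∀ i, dV i ≠ 0) (hdW0 : ∀ i, dW i ≠ 0) (ρ : Fin n ≃ Fin 2) (S : Matrix (Fin n) (Fin n) L)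
    (hS : S ∈ skewMatrices ((IsCMField.complexConj L : L ≃ₐ[Fp L] L) : L →+* L) ((gramR L e dV hdV dW hdW).map (algebraMap (Fp L) L)))
    (hSdet : S.det ≠ 0) :
    ∃ (βloc : Matrix (Fin 2) (Fin 2) (LocalRing L v)) (χ : ↥(unipDeltaLoc L e dV hdV dW hdW v) →* ℂˣ),
      (βloc.map (conjLocal L (IsCMField.complexConj L) v))ᵀ = βloc ∧ βloc.det ≠ 0 ∧
      (∀ z : ↥(unipDeltaLoc L e dV hdV dW hdW v), ((χ z : ℂˣ) : ℂ) =
        (unipDeltaChar L e dV hdV dW hdW S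
          (locToAdelic L e dV hdV dW hdW v (z : UnitaryGroup.localPi L (IsCMField.complexConj L) (n + n) (hermD L e dV hdV dW hdW) v)) : ℂ)) ∧
      (∀ z : ↥(unipDeltaLoc L e dV hdV dW hdW v), ((χ z : ℂˣ) : ℂ) =
        ((adeleAddCharAt (Fp L) v (Algebra.trace (v.adicCompletion (Fp L)) (LocalRing L v) (Matrix.trace
          (Matrix.reindex ρ ρ (algebraMap L (LocalRing L v) (imagUnit L) •
              ((((blk L e dV hdV dW hdW (locToAdelic L e dV hdV dW hdW v
                  (z : UnitaryGroup.localPi L (IsCMField.complexConj L) (n + n) (hermD L e dV hdV dW hdW) v))).toBlocks₁₂).map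
                  (fun x : AdeleRing (𝓞 L) L => finiteAdeleToLocal L v x.2)) *
                (((gramR L e dV hdV dW hdW).map (algebraMap (Fp L) L)).map (algebraMap L (LocalRing L v)))⁻¹)) * βloc))) : Circle) : ℂ)) := by
  haveI : Algebra.IsQuadraticExtension (Fp L) L := IsCMField.isQuadraticExtension L
  obtain ⟨hTc, hTt, hTu⟩ := localGram_map_conj_transpose_isUnit L e dV hdV dW hdW v hdV0 hdW0
  -- the local index is `T_v`-skew
  have hSv : (((gramR L e dV hdV dW hdW).map (algebraMap (Fp L) L)).map (algebraMap L (LocalRing L v))) * (S.map (algebraMap L (LocalRing L v))) + ((S.map (algebraMap L (LocalRing L v))).map (conjLocal L (IsCMField.complexConj L) v))ᵀ * (((gramR L e dV hdV dW hdW).map (algebraMap (Fp L) L)).map (algebraMap L (LocalRing L v))) = 0 :=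
    (mem_skewMatrices_iff _ _ _).1 (map_mem_skewMatrices (algebraMap L (LocalRing L v))
      (fun x => (conjLocal_algebraMap (IsCMField.complexConj L) v x).symm) hS)
  -- `δ`, `d`, `δ⁻¹ = d⁻¹ δ`
  have hd0 : imagUnitSq L ≠ 0 := by
    intro h0
    have h := imagUnit_mul_self L
    rw [h0, map_zero, mul_self_eq_zero] at h
    exact imagUnit_ne_zero L h
  have hdv0 : ((imagUnitSq L : Fp L) : v.adicCompletion (Fp L)) ≠ 0 := fun h0 =>
    hd0 ((algebraMap (Fp L) (v.adicCompletion (Fp L))).injective (h0.trans (map_zero _).symm))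
  have hδ2 : (algebraMap L (LocalRing L v) (imagUnit L)) * (algebraMap L (LocalRing L v) (imagUnit L)) = toLocalRing L v ((imagUnitSq L : Fp L) : v.adicCompletion (Fp L)) := by
    rw [← map_mul, imagUnit_mul_self, ← toLocalRing_coe]
  have hδδinv : (algebraMap L (LocalRing L v) (imagUnit L)) * (toLocalRing L v (((imagUnitSq L : Fp L) : v.adicCompletion (Fp L)))⁻¹ * (algebraMap L (LocalRing L v) (imagUnit L))) = 1 := by
    rw [mul_left_comm, hδ2, ← map_mul, inv_mul_cancel₀ hdv0, map_one]
  have hσδinv : conjLocal L (IsCMField.complexConj L) v (toLocalRing L v (((imagUnitSq L : Fp L) : v.adicCompletion (Fp L)))⁻¹ * (algebraMap L (LocalRing L v) (imagUnit L))) = -(toLocalRing L v (((imagUnitSq L : Fp L) : v.adicCompletion (Fp L)))⁻¹ * (algebraMap L (LocalRing L v) (imagUnit L))) := by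
    rw [map_mul, conjLocal_toLocalRing, conjLocal_algebraMap, complexConj_imagUnit, map_neg, mul_neg]
  -- the hermitian index `βloc`
  have hherm0 : (((toLocalRing L v (((imagUnitSq L : Fp L) : v.adicCompletion (Fp L)))⁻¹ * (algebraMap L (LocalRing L v) (imagUnit L))) • ((((gramR L e dV hdV dW hdW).map (algebraMap (Fp L) L)).map (algebraMap L (LocalRing L v))) * (S.map (algebraMap L (LocalRing L v))))).map (conjLocal L (IsCMField.complexConj L) v))ᵀ = (toLocalRing L v (((imagUnitSq L : Fp L) : v.adicCompletion (Fp L)))⁻¹ * (algebraMap L (LocalRing L v) (imagUnit L))) • ((((gramR L e dV hdV dW hdW).map (algebraMap (Fp L) L)).map (algebraMap L (LocalRing L v))) * (S.map (algebraMap L (LocalRing L v)))) :=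
    map_transpose_smul_mul_of_skew (conjLocal L (IsCMField.complexConj L) v) _ hσδinv _ _ hTc hTt hSv
  have hdet0 : ((toLocalRing L v (((imagUnitSq L : Fp L) : v.adicCompletion (Fp L)))⁻¹ * (algebraMap L (LocalRing L v) (imagUnit L))) • ((((gramR L e dV hdV dW hdW).map (algebraMap (Fp L) L)).map (algebraMap L (LocalRing L v))) * (S.map (algebraMap L (LocalRing L v))))).det ≠ 0 := by
    rw [det_smul_mul, mul_assoc]
    refine ((IsUnit.of_mul_eq_one_right _ hδδinv).pow _).mul_right_eq_zero.not.mpr (hTu.mul_right_eq_zero.not.mpr ?_)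
    rw [← RingHom.mapMatrix_apply, ← RingHom.map_det]
    exact fun h => hSdet (algebraMap_localRing_injective L v (h.trans (map_zero _).symm))
  -- the character
  obtain ⟨χ, hχS⟩ := K2LiuFirstTermLineLiftRankRowSmallLetters.exists_hom_coe_eq_unipDeltaChar_locToAdelic L e dV hdV dW hdW v S
  refine ⟨Matrix.reindex ρ ρ ((toLocalRing L v (((imagUnitSq L : Fp L) : v.adicCompletion (Fp L)))⁻¹ * (algebraMap L (LocalRing L v) (imagUnit L))) • ((((gramR L e dV hdV dW hdW).map (algebraMap (Fp L) L)).map (algebraMap L (LocalRing L v))) * (S.map (algebraMap L (LocalRing L v))))), χ, map_transpose_reindex ρ _ _ hherm0, by rwa [Matrix.det_reindex_self], hχS, fun z => ?_⟩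
  rw [hχS, unipDeltaChar_locToAdelic_eq_adeleAddCharAt_trace, trace_reindex_mul_reindex,
    trace_delta_smul_mul_inv_mul _ _ _ _ _ _ (Matrix.nonsing_inv_mul _ hTu), hδδinv, one_mul]

end Instance

end Summit.HodgeConjecture.HodgeConjecture.Cruxes.HLiu418.K2LiuFinLineModelLettersAtPlace

end
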